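import Summits.AtomisticToContinuum.Crystallization.Theorems.FrustratedLawDichotomyTextureAllBad

/-!
# FrustratedLawDichotomy · crux `AperiodicFrustratedLawGap` (stmt-AtomisticToContinuum-27623) — goodness transfer at the COARSE threshold
# (decomp-a2c, prover hand 1, direct share, generation 6; building block for the transfer of texture clause (5))

The texture transfers I–III of generation 4 (`TextureFineShells`, `TextureAllBad`, `TextureHolesOrNonT`) read clauses (4), (2), (3) of the
crux's texture on the charged configuration; clause (5) — «within `R₉` of every site there is a COARSE (not `1/8`-good) tetrahedral site, or a
coarse majority» — is the icosahedral / Frank–Kasper content and is not yet transferred.  Its transfer needs the goodness-transfer engine of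
`TextureAllBad` at the threshold `1/8` instead of `1/20`; this file supplies it (`good_transfer_core_eighth`, same proof, numerals moved), so
that a successor can assemble «a.s. within `R₉ + ε` of every atom there is an atom that is not robustly `1/8`-good» (coarse sites are
`(R₉ + ε)`-ubiquitous, hence have positive Palm frequency by `FrustratedLawDichotomyPalmFrequency.measure_univ_le_mul_of_ubiquitous`) —
see the recipe in the module docstring of a future `FrustratedLawDichotomyTextureCoarseSites`.  All `[folklore]`.  No definitions, no `sorry`.
-/

noncomputable section

namespace Summit.AtomisticToContinuum.Crystallization.Theorems.FrustratedLawDichotomyTextureCoarseCore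

open MeasureTheory Literature.Probability.Process Literature.Geometry.DiscreteGeometry
open Summit.AtomisticToContinuum.Crystallization.Theorems.FrustratedLawDichotomyTextureFineShells
  (norm_sub_smul_eq fccKissingPattern_nonempty hcpKissingPattern_nonempty)

/-- **Goodness-transfer engine at the COARSE threshold `1/8`** (the `1/20`-engine `FrustratedLawDichotomyTextureAllBad.good_transfer_core`
with its numerals moved: tolerance `η < 1/8`, `40ε ≤ d(1 − 8η)`): a robustly `η`-good atom `p` of the separated set `S` (scale `d`, isometry `A`,
shell atoms `t u`, shell gap `γ`) makes the matched site `j` of any fine enough two-way matched `7/10`-separated approximant `y`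
(radius `R ≥ 2d + γ + 2`, tolerance `ε` with `40ε ≤ d(1 − 8η)`, `5ε ≤ γ`, `4ε < δ`) `1/8`-GOOD for the same pattern.  This is the engine a
transfer of the texture clause (5) («coarse sites within `R₉`») to the charged configuration needs: contrapositively, a COARSE
(not `1/8`-good) approximant site is matched to an atom that is not robustly `η`-good for any `η < 1/8`. [folklore] -/
theorem good_transfer_core_eighth {S : Set (EuclideanSpace ℝ (Fin 3))} {δ : ℝ}
    (hS : ∀ x ∈ S, ∀ x' ∈ S, x ≠ x' → δ ≤ dist x x')
    {N : ℕ} {y : Fin N → EuclideanSpace ℝ (Fin 3)} {i j : Fin N} {p : EuclideanSpace ℝ (Fin 3)} {R ε : ℝ}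
    (hsepY : ∀ a b : Fin N, a ≠ b → (7 : ℝ) / 10 ≤ dist (y a) (y b))
    (hm1 : ∀ s ∈ S, dist s p ≤ R → ∃ a : Fin N, dist (y a - y i) (s - p) ≤ ε)
    (hm2 : ∀ a : Fin N, dist (y a) (y i) ≤ R → ∃ s ∈ S, dist (y a - y i) (s - p) ≤ ε)
(hp : p ∈ S) (hj : dist (y j - y i) (p - p) ≤ ε)
    {Pat : Finset (EuclideanSpace ℝ (Fin 3))} (hPat : Pat.Nonempty) (hPatn : ∀ u ∈ Pat, ‖u‖ = 1)
    (hPat1 : ∀ u ∈ Pat, ∀ u' ∈ Pat, u ≠ u' → 1 ≤ dist u u')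
    {d η γ : ℝ} {A : EuclideanSpace ℝ (Fin 3) →ₗᵢ[ℝ] EuclideanSpace ℝ (Fin 3)} {t : ↥Pat → EuclideanSpace ℝ (Fin 3)}
    (hd : 0 < d) (hη : η < 1 / 8)
    (ht : ∀ u : ↥Pat, t u ∈ S ∧ ‖(t u - p) - d • A (u : EuclideanSpace ℝ (Fin 3))‖ ≤ η * d)
    (hnn₁ : ∀ s ∈ S, s ≠ p → d ≤ dist s p) (hnn₂ : ∃ s ∈ S, s ≠ p ∧ dist s p ≤ d)
    (hgap : ∀ s ∈ S, s ≠ p → dist s p < 13 / 10 * d + γ → dist s p ≤ 13 / 10 * d - γ ∧ s ∈ Set.range t)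
    (hε0 : 0 < ε) (hεη : 40 * ε ≤ d * (1 - 8 * η)) (hεγ : 5 * ε ≤ γ) (hεδ : 4 * ε < δ) (hε7 : 4 * ε < 7 / 10)
    (hR : 2 * d + γ + 2 ≤ R)
    {dj : ℝ} (hdj : dj = sInf ((fun z => dist z (y j)) '' (Set.range y \ {y j}))) :
    ∃ e : ↥{z : EuclideanSpace ℝ (Fin 3) | z ∈ Set.range y ∧ z ≠ y j ∧ dist z (y j) < 13 / 10 * dj} ≃ ↥Pat,
      ∀ z : ↥{z : EuclideanSpace ℝ (Fin 3) | z ∈ Set.range y ∧ z ≠ y j ∧ dist z (y j) < 13 / 10 * dj},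
        dist (dj⁻¹ • ((z : EuclideanSpace ℝ (Fin 3)) - y j)) (A ((e z : ↥Pat) : EuclideanSpace ℝ (Fin 3))) ≤ 1 / 8 := by
  -- numerics
  have hηpos : 0 ≤ η := by
    obtain ⟨u₀, hu₀⟩ := hPat
    have h1 := (ht ⟨u₀, hu₀⟩).2
    have h2 : 0 ≤ ‖(t ⟨u₀, hu₀⟩ - p) - d • A ((⟨u₀, hu₀⟩ : ↥Pat) : EuclideanSpace ℝ (Fin 3))‖ := norm_nonneg _
    nlinarith
  have hη0 : 0 ≤ 1 - 8 * η := by linarith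
  have hεd : 40 * ε ≤ d := by nlinarith
  have hyj : ‖y j - y i‖ ≤ ε := by
    have := hj
    rwa [sub_self, dist_zero_right] at this
  have key : ∀ (a : Fin N) (s : EuclideanSpace ℝ (Fin 3)), dist (y a - y i) (s - p) ≤ ε →
      ‖(y a - y j) - (s - p)‖ ≤ 2 * ε := by
    intro a s h
    have hid : (y a - y j) - (s - p) = ((y a - y i) - (s - p)) + (y i - y j) := by abel
    rw [hid]
    calc ‖((y a - y i) - (s - p)) + (y i - y j)‖ ≤ ‖(y a - y i) - (s - p)‖ + ‖y i - y j‖ := norm_add_le _ _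
      _ ≤ ε + ε := add_le_add (by rw [← dist_eq_norm]; exact h) (by rw [norm_sub_rev]; exact hyj)
      _ = 2 * ε := by ring
  have htu_norm : ∀ u : ↥Pat, d * (1 - η) ≤ ‖t u - p‖ ∧ ‖t u - p‖ ≤ d * (1 + η) := by
    intro u
    have h1 := (ht u).2
    have h2 : ‖d • A (u : EuclideanSpace ℝ (Fin 3))‖ = d := by
      rw [norm_smul, Real.norm_eq_abs, abs_of_pos hd, A.norm_map, hPatn u u.2, mul_one]
    constructor
    · have h3 := norm_sub_norm_le (d • A (u : EuclideanSpace ℝ (Fin 3))) (t u - p)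
      rw [h2, norm_sub_rev (d • A (u : EuclideanSpace ℝ (Fin 3))) (t u - p)] at h3
      nlinarith
    · have h3 : ‖t u - p‖ ≤ ‖(t u - p) - d • A (u : EuclideanSpace ℝ (Fin 3))‖ + ‖d • A (u : EuclideanSpace ℝ (Fin 3))‖ := by
        calc ‖t u - p‖ = ‖((t u - p) - d • A (u : EuclideanSpace ℝ (Fin 3))) + d • A (u : EuclideanSpace ℝ (Fin 3))‖ := by
              rw [sub_add_cancel]
          _ ≤ _ := norm_add_le _ _
      rw [h2] at h3
      nlinarith
  have htu_ne : ∀ u : ↥Pat, t u ≠ p := by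
    intro u h
    have := (htu_norm u).1
    rw [h, sub_self, norm_zero] at this
    nlinarith
  have htu_sep : ∀ u u' : ↥Pat, u ≠ u' → d * (1 - 2 * η) ≤ ‖t u - t u'‖ := by
    intro u u' hne
    have h1 := (ht u).2
    have h2 := (ht u').2
    have hne' : (u : EuclideanSpace ℝ (Fin 3)) ≠ u' := fun h => hne (Subtype.ext h)
    have h3 : d ≤ ‖d • A (u : EuclideanSpace ℝ (Fin 3)) - d • A (u' : EuclideanSpace ℝ (Fin 3))‖ := by
      rw [← smul_sub, norm_smul, Real.norm_eq_abs, abs_of_pos hd, ← map_sub, A.norm_map, ← dist_eq_norm]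
      nlinarith [hPat1 u u.2 u' u'.2 hne']
    have hid : d • A (u : EuclideanSpace ℝ (Fin 3)) - d • A (u' : EuclideanSpace ℝ (Fin 3)) =
        (t u - t u') - (((t u - p) - d • A (u : EuclideanSpace ℝ (Fin 3))) - ((t u' - p) - d • A (u' : EuclideanSpace ℝ (Fin 3)))) := by abel
    rw [hid] at h3
    have h4 := norm_sub_le (t u - t u') (((t u - p) - d • A (u : EuclideanSpace ℝ (Fin 3))) - ((t u' - p) - d • A (u' : EuclideanSpace ℝ (Fin 3))))
    have h5 := norm_sub_le ((t u - p) - d • A (u : EuclideanSpace ℝ (Fin 3))) ((t u' - p) - d • A (u' : EuclideanSpace ℝ (Fin 3)))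
    nlinarith
  have t_inj : ∀ u u' : ↥Pat, ‖t u - t u'‖ ≤ 4 * ε → u = u' := by
    intro u u' h
    by_contra hne
    have := htu_sep u u' hne
    nlinarith
  have hDbdd : BddBelow ((fun z => dist z (y j)) '' (Set.range y \ {y j})) :=
    ⟨0, by rintro b ⟨z, -, rfl⟩; exact dist_nonneg⟩
  have hdj_le : ∀ a : Fin N, y a ≠ y j → dj ≤ dist (y a) (y j) :=
    fun a ha => hdj ▸ csInf_le hDbdd ⟨y a, ⟨⟨a, rfl⟩, ha⟩, rfl⟩
  have hfar : ∀ (a : Fin N) (s : EuclideanSpace ℝ (Fin 3)), s ∈ S → dist (y a - y i) (s - p) ≤ ε → y a ≠ y j → s ≠ p := by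
    intro a s hs h hne hsp
    have h1 := key a s h
    rw [hsp, sub_self, sub_zero, ← dist_eq_norm] at h1
    have : (7 : ℝ) / 10 ≤ dist (y a) (y j) := hsepY a j (fun h => hne (by rw [h]))
    linarith
  have hdj_ge : d - 2 * ε ≤ dj := by
    obtain ⟨u₀, hu₀⟩ := hPat
    -- non-emptiness of the distance set via the matched shell atom `t u₀`
    have hdη : d * (1 + η) ≤ 2 * d := by nlinarith
    obtain ⟨a₀, ha₀⟩ := hm1 (t ⟨u₀, hu₀⟩) (ht _).1 (by
      have := (htu_norm ⟨u₀, hu₀⟩).2; rw [dist_eq_norm]; linarith)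
    have ha₀j : y a₀ ≠ y j := by
      intro h
      have h1 := key a₀ _ ha₀
      rw [h, sub_self, zero_sub, norm_neg] at h1
      have h2 := (htu_norm ⟨u₀, hu₀⟩).1
      have h3 : d * (1 - η) ≥ d * (7 / 8) := by nlinarith
      linarith
    rw [hdj]
    refine le_csInf ⟨_, ⟨y a₀, ⟨⟨a₀, rfl⟩, ha₀j⟩, rfl⟩⟩ ?_
    rintro b ⟨z, ⟨⟨a, rfl⟩, hz⟩, rfl⟩
    have haj : y a ≠ y j := fun h => hz h
    by_cases haR : dist (y a) (y i) ≤ R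
    · obtain ⟨s, hs, has⟩ := hm2 a haR
      have hsp := hfar a s hs has haj
      have h1 := hnn₁ s hs hsp
      have h2 := key a s has
      have h3 : dist s p ≤ dist (y a) (y j) + 2 * ε := by
        rw [dist_eq_norm, dist_eq_norm]
        calc ‖s - p‖ = ‖(y a - y j) - ((y a - y j) - (s - p))‖ := by congr 1; abel
          _ ≤ ‖y a - y j‖ + ‖(y a - y j) - (s - p)‖ := norm_sub_le _ _
          _ ≤ ‖y a - y j‖ + 2 * ε := by linarith
      show d - 2 * ε ≤ dist (y a) (y j)
      linarith
    · push Not at haR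
      show d - 2 * ε ≤ dist (y a) (y j)
      have h1 : dist (y a) (y i) ≤ dist (y a) (y j) + dist (y j) (y i) := dist_triangle _ _ _
      rw [dist_eq_norm (y j)] at h1
      linarith
  have hdj_le' : dj ≤ d + 2 * ε := by
    obtain ⟨s₀, hs₀, hs₀p, hs₀d⟩ := hnn₂
    obtain ⟨a₀, ha₀⟩ := hm1 s₀ hs₀ (by linarith)
    have ha₀j : y a₀ ≠ y j := by
      intro h
      have h1 := key a₀ s₀ ha₀
      rw [h, sub_self, zero_sub, norm_neg, ← dist_eq_norm] at h1
      have := hS s₀ hs₀ p hp hs₀p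
      linarith
    have h1 := hdj_le a₀ ha₀j
    have h2 := key a₀ s₀ ha₀
    have h3 : dist (y a₀) (y j) ≤ dist s₀ p + 2 * ε := by
      rw [dist_eq_norm, dist_eq_norm]
      calc ‖y a₀ - y j‖ = ‖(s₀ - p) + ((y a₀ - y j) - (s₀ - p))‖ := by congr 1; abel
        _ ≤ ‖s₀ - p‖ + ‖(y a₀ - y j) - (s₀ - p)‖ := norm_add_le _ _
        _ ≤ ‖s₀ - p‖ + 2 * ε := by linarith
    linarith
  have hdjpos : 0 < dj := by linarith
  -- every shell site of `j` is matched to a shell atom `t u`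
  have hshell : ∀ z : ↥{z : EuclideanSpace ℝ (Fin 3) | z ∈ Set.range y ∧ z ≠ y j ∧ dist z (y j) < 13 / 10 * dj},
      ∃ u : ↥Pat, ‖((z : EuclideanSpace ℝ (Fin 3)) - y j) - (t u - p)‖ ≤ 2 * ε := by
    intro z
    obtain ⟨⟨a, ha⟩, hne, hlt⟩ := z.2
    have haR : dist (y a) (y i) ≤ R := by
      have h1 : dist (y a) (y i) ≤ dist (y a) (y j) + dist (y j) (y i) := dist_triangle _ _ _
      rw [dist_eq_norm (y j)] at h1
      rw [ha] at h1 ⊢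
      have hlt' : dist (z : EuclideanSpace ℝ (Fin 3)) (y j) < 13 / 10 * dj := hlt
      nlinarith
    obtain ⟨s, hs, has⟩ := hm2 a haR
    have haj : y a ≠ y j := by rw [ha]; exact hne
    have hsp := hfar a s hs has haj
    have h2 := key a s has
    rw [ha] at h2
    have h3 : dist s p < 13 / 10 * d + γ := by
      have hlt' : dist (z : EuclideanSpace ℝ (Fin 3)) (y j) < 13 / 10 * dj := hlt
      rw [dist_eq_norm] at hlt' ⊢
      calc ‖s - p‖ = ‖((z : EuclideanSpace ℝ (Fin 3)) - y j) - (((z : EuclideanSpace ℝ (Fin 3)) - y j) - (s - p))‖ := by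
            congr 1; abel
        _ ≤ ‖(z : EuclideanSpace ℝ (Fin 3)) - y j‖ + ‖((z : EuclideanSpace ℝ (Fin 3)) - y j) - (s - p)‖ := norm_sub_le _ _
        _ < 13 / 10 * dj + 2 * ε := by linarith
        _ ≤ 13 / 10 * d + γ := by nlinarith
    obtain ⟨-, ⟨u, hu⟩⟩ := hgap s hs hsp h3
    exact ⟨u, by rw [hu]; exact h2⟩
  choose f hf using hshell
  have f_inj : Function.Injective f := by
    intro z z' h
    have h1 := hf z
    have h2 := hf z'
    rw [h] at h1
    obtain ⟨⟨a, ha⟩, -, -⟩ := z.2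
    obtain ⟨⟨a', ha'⟩, -, -⟩ := z'.2
    apply Subtype.ext
    rw [← ha, ← ha']
    by_contra hne
    have haa : a ≠ a' := fun h => hne (by rw [h])
    have h3 := hsepY a a' haa
    rw [dist_eq_norm] at h3
    have h4 : ‖y a - y a'‖ ≤ 2 * ε + 2 * ε := by
      calc ‖y a - y a'‖ = ‖(((z : EuclideanSpace ℝ (Fin 3)) - y j) - (t (f z') - p)) - (((z' : EuclideanSpace ℝ (Fin 3)) - y j) - (t (f z') - p))‖ := by
            rw [ha, ha']; congr 1; abel
        _ ≤ _ := norm_sub_le _ _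
        _ ≤ 2 * ε + 2 * ε := add_le_add h1 h2
    linarith
  have f_surj : Function.Surjective f := by
    intro u
    have hdη : d * (1 + η) ≤ 2 * d := by nlinarith
    obtain ⟨a, ha⟩ := hm1 (t u) (ht u).1 (by
      have := (htu_norm u).2; rw [dist_eq_norm]; linarith)
    have h2 := key a _ ha
    have haj : y a ≠ y j := by
      intro h
      rw [h, sub_self, zero_sub, norm_neg] at h2
      have h3 := (htu_norm u).1
      have h4 : d * (1 - η) ≥ d * (7 / 8) := by nlinarith
      linarith
    have halt : dist (y a) (y j) < 13 / 10 * dj := by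
      rw [dist_eq_norm]
      calc ‖y a - y j‖ = ‖(t u - p) + ((y a - y j) - (t u - p))‖ := by congr 1; abel
        _ ≤ ‖t u - p‖ + ‖(y a - y j) - (t u - p)‖ := norm_add_le _ _
        _ ≤ d * (1 + η) + 2 * ε := add_le_add (htu_norm u).2 h2
        _ < 13 / 10 * dj := by
            have : d * η < d * (1 / 8) := mul_lt_mul_of_pos_left hη hd
            linarith
    refine ⟨⟨y a, ⟨a, rfl⟩, haj, halt⟩, ?_⟩
    apply t_inj
    have h3 := hf ⟨y a, ⟨a, rfl⟩, haj, halt⟩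
    calc ‖t (f ⟨y a, ⟨a, rfl⟩, haj, halt⟩) - t u‖
        = ‖((y a - y j) - (t u - p)) - ((y a - y j) - (t (f ⟨y a, ⟨a, rfl⟩, haj, halt⟩) - p))‖ := by congr 1; abel
      _ ≤ ‖(y a - y j) - (t u - p)‖ + ‖(y a - y j) - (t (f ⟨y a, ⟨a, rfl⟩, haj, halt⟩) - p)‖ := norm_sub_le _ _
      _ ≤ 2 * ε + 2 * ε := add_le_add h2 h3
      _ = 4 * ε := by ring
  refine ⟨Equiv.ofBijective f ⟨f_inj, f_surj⟩, fun z => ?_⟩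
  rw [Equiv.ofBijective_apply]
  have h1 := hf z
  have h2 := (ht (f z)).2
  have h3 : ‖d • A ((f z : ↥Pat) : EuclideanSpace ℝ (Fin 3)) - dj • A ((f z : ↥Pat) : EuclideanSpace ℝ (Fin 3))‖ ≤ 2 * ε := by
    rw [← sub_smul, norm_smul, A.norm_map, hPatn _ (f z).2, mul_one, Real.norm_eq_abs, abs_le]
    constructor <;> linarith
  have h4 : ‖((z : EuclideanSpace ℝ (Fin 3)) - y j) - dj • A ((f z : ↥Pat) : EuclideanSpace ℝ (Fin 3))‖ ≤ η * d + 4 * ε := by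
    calc ‖((z : EuclideanSpace ℝ (Fin 3)) - y j) - dj • A ((f z : ↥Pat) : EuclideanSpace ℝ (Fin 3))‖
        = ‖(((z : EuclideanSpace ℝ (Fin 3)) - y j) - (t (f z) - p)) + ((t (f z) - p) - d • A ((f z : ↥Pat) : EuclideanSpace ℝ (Fin 3))) +
            (d • A ((f z : ↥Pat) : EuclideanSpace ℝ (Fin 3)) - dj • A ((f z : ↥Pat) : EuclideanSpace ℝ (Fin 3)))‖ := by congr 1; abel
      _ ≤ ‖((z : EuclideanSpace ℝ (Fin 3)) - y j) - (t (f z) - p)‖ + ‖(t (f z) - p) - d • A ((f z : ↥Pat) : EuclideanSpace ℝ (Fin 3))‖ +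
            ‖d • A ((f z : ↥Pat) : EuclideanSpace ℝ (Fin 3)) - dj • A ((f z : ↥Pat) : EuclideanSpace ℝ (Fin 3))‖ := norm_add₃_le
      _ ≤ 2 * ε + η * d + 2 * ε := add_le_add (add_le_add h1 h2) h3
      _ = η * d + 4 * ε := by ring
  have h5 : dist (dj⁻¹ • ((z : EuclideanSpace ℝ (Fin 3)) - y j)) (A ((f z : ↥Pat) : EuclideanSpace ℝ (Fin 3))) =
      dj⁻¹ * ‖((z : EuclideanSpace ℝ (Fin 3)) - y j) - dj • A ((f z : ↥Pat) : EuclideanSpace ℝ (Fin 3))‖ := by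
    rw [norm_sub_smul_eq hdjpos, ← mul_assoc, inv_mul_cancel₀ hdjpos.ne', one_mul]
  rw [h5, inv_mul_le_iff₀ hdjpos]
  nlinarith

/-! ## Unpacking clause (5): a coarse site within `R₉` of the centre -/

/-- **Clauses (2) + (5) of the texture give a COARSE site within `R₉` of the centre** (approximant level, abstract in the two goodness
predicates `G20` = `Gy (1/20)` and `G8` = `Gy (1/8)` and in the tetrahedral-site predicate `T`).  If every site within `R` of the centre
`i` is `1/20`-bad (clause (2)), `R₉ ≤ R`, and clause (5) holds at the centre — NOT [all sites within `R₉` are `1/20`-bad ∧ the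
coarse sites within `R₉` are at most half ∧ every coarse site within `R₉` is non-`T`] — then some site within `R₉` of the centre is coarse
(not `1/8`-good): otherwise the three conjuncts hold (the second with `0` coarse sites, the third vacuously). [folklore] -/
theorem exists_coarse_site {N : ℕ} (y : Fin N → EuclideanSpace ℝ (Fin 3)) (i : Fin N) {R R₉ : ℝ} (hR₉ : R₉ ≤ R)
    (G20 G8 T : Fin N → Prop)
    (h2 : ∀ j : Fin N, dist (y j) (y i) ≤ R → ¬ G20 j)
    (h5 : ¬ ((∀ j' : Fin N, dist (y j') (y i) ≤ R₉ → ¬ G20 j') ∧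
      (Nat.card {j' : Fin N // dist (y j') (y i) ≤ R₉ ∧ ¬ G8 j'} : ℝ) ≤ 1 / 2 * (Nat.card {j' : Fin N // dist (y j') (y i) ≤ R₉} : ℝ) ∧
      (∀ j' : Fin N, dist (y j') (y i) ≤ R₉ → ¬ G8 j' → ¬ T j'))) :
    ∃ j' : Fin N, dist (y j') (y i) ≤ R₉ ∧ ¬ G8 j' := by
  by_contra hno
  push Not at hno
  apply h5
  refine ⟨fun j' hj' => h2 j' (hj'.trans hR₉), ?_, fun j' hj' hng => absurd (hno j' hj') hng⟩
  have hempty : IsEmpty {j' : Fin N // dist (y j') (y i) ≤ R₉ ∧ ¬ G8 j'} :=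
    ⟨fun j' => j'.2.2 (hno j'.1 j'.2.1)⟩
  rw [Nat.card_of_isEmpty, Nat.cast_zero]
  positivity

end Summit.AtomisticToContinuum.Crystallization.Theorems.FrustratedLawDichotomyTextureCoarseCore

end
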